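import Literature.NumberTheory.GaloisCohomology.Howard2004.CasselsTateSkewPairingParityFormProofs
import Literature.NumberTheory.GaloisCohomology.Howard2004.DVRSettingPiRefinementConclusion
import Literature.NumberTheory.GaloisCohomology.Howard2004.SelmerAtPresentationProofs
import Literature.NumberTheory.GaloisCohomology.Howard2004.DVRSettingLevelTrivialityProofs
import HarnessLib

/-!
# Howard 2004, Thm. 1.4.2-as-applied (`HasLevelDecompositionsAt`) DESCENDS along the `π`-adic refinement of a
# `DVRSetting`; hence the typed Flach leaf C45.1′ follows from Thm. 1.4.2 on FULL towers `T^{(k)} = T/𝔪^kT` — proofs file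

Topic `NumberTheory/GaloisCohomology/Howard2004`. THEOREMS ONLY: no definition, no named fact, no instance, no notation, no `sorry`.
Cell `pub/bsd-print-x9` (seat x10b-p1-w7 g11, brick «C451-REFINE-TRANSFER», `--supports stmt-BirchSwinnertonDyer-22642`).
Sequel of `CasselsTateSkewPairingParityFormProofs` / `CasselsTateSkewPairingOfLevelDecompositionsProofs` (this seat:
C45.1′ ⟺ form (α) ⟺ parity), of the refinement programme REFINE (`DVRSettingPiRefinement*`, `bsd-line-x10b-p1` LEAD g12 /
x10b-p1-w2: `S.refine hy pins`, `refine_satisfiesH`, the marked levels `proj : T^{(k)} ≅ T/π^{e_k}T` with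
`proj_bijective_of_eq_e`, `isQuotientBy_levelRep`, `refinedCond_apply_eq_map`, `kolyvaginPrimes_subset_refinedTower`), of
`SelmerAtPresentationProofs` (x10b-p1-w2 g15: `IsQuotientBy.cohomologyMap_mem_selmerGroup_propagateStructure_iff`,
`exists_mem_selmerGroup_cohomologyMap_eq`, `bijective_(local)cohomologyMap_of_ker_eq_bot`), of `TransverseCartesianProofs`
(`comap_cohomologyMap_transverseCondition_eq`) and `DVRSettingLevelTrivialityProofs` (`htriv_of_subset_levelPrimes`).

SOURCE. B. Howard, *The Heegner point Kolyvagin system*, Compositio Math. **140** (2004) = arXiv:1202.6340, §1.6 ¶1 (p0011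
L33–44): Howard's tower IS the full tower «`R^{(k)} = R/𝔪^k`, `T^{(k)} = T/𝔪^kT` … By Remark 1.3.1 the Selmer triple
`(T^{(k)}, F, 𝓛^{(k)})` satisfies hypotheses H.0–H.5 … for `n ∈ 𝓝^{(k)}` we have a decomposition
`H¹_{F(n)}(K, T^{(k)}) ≅ R^{(k),ε} ⊕ M^{(k)}(n) ⊕ M^{(k)}(n)`»; Def. 1.1.3 (p0005 L93–99: objects of `Quot(T)` up to their
canonical isomorphism); Lemma 1.3.3 (p0007 L152–160).  The tree's `DVRSetting` allows any strictly increasing exponents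
`e_k`; the cell proves the per-setting content on FULL settings and REFINES a general one (LEAD ruling (β); `conclusion_of_refine`
is the analogous descent of the conclusion of Thm. 1.6.1).

WHAT IS PROVED.
* §1 `propagateStructure_atLevel_cond_eq_refinedTriple_atLevel` — at a marked index `j = e_k` and `n ∈ 𝓝^{(k)}`, the modified
  structure `F(n)` on `T^{(k)}` propagates along `proj` EXACTLY to `F♯(n)` on `T/π^jT` (places of `n`: the transverse condition
  maps onto the transverse condition; elsewhere the refined condition is the image by definition).
* §2 (generic, any two settings and a presentation `ι : T^{(k)} → T'^{(k')}` with `ker ι = 0` carrying `F(n)` to `F'(n)`)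
  `exists_selmerGroup_addEquiv_of_isQuotientBy` (`H¹(K, ι)` is an `R`-equivariant additive bijection of the `F(n)`-Selmer
  groups) and **`hasLevelDecompositionsAt_of_marked`** (Thm. 1.4.2-as-applied descends along marked levels of equal exponent).
* §3 `subset_levelPrimes_refine`, **`hasLevelDecompositionsAt_of_refine`**:
  `(S.refine hy pins).HasLevelDecompositionsAt _ → S.HasLevelDecompositionsAt hy`.
* §4 **`prop141_casselsTate_skewPairing_atLevel_of_forall_full_hasLevelDecompositionsAt`**,
  **`prop141_casselsTate_skewPairing_atLevel_iff_forall_full_hasLevelDecompositionsAt`**,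
  **`prop141_casselsTate_skewPairing_atLevel_iff_forall_full_even_length_torsionLayer`** — the typed leaf C45.1′ holds IFF
  Thm. 1.4.2-as-applied (resp. the even-layers parity) holds on every FULL `DVRSetting` (`e_i = i + 1`) with H.0–H.5.

READING (numbers, for the desk): a kernel proof of Howard's Thm. 1.4.2 / Flach's pairing carried out on FULL towers only — where
`T/𝔪^sT` and `T*[𝔪^t] ≅ Tw(T/𝔪^tT)` are tower LEVELS with their own triples and H.3/H.4 data — closes the leaf BY NAME.
Lean note: statements about `S.refine` inline their `letI` instances; the proofs therefore go through the GENERIC §2 and meet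
`S.refine` only in small `rfl`-type letters (as `conclusion_of_refine` does), never by rewriting inside the large Selmer types.
HONEST FRAMING: nothing here proves Thm. 1.4.2, Prop. 1.4.1, `thm161_dvrKolyvaginBound` or C45.1′; no summit statement is
proved; the Birch–Swinnerton-Dyer conjecture is not proved by any of this.
-/

set_option autoImplicit false

noncomputable section

open Function NumberField IsDedekindDomain Field
open scoped NumberField ContRepresentation Classical Pointwise

namespace Literature.NumberTheory.GaloisCohomology.Howard2004

open Literature.NumberTheory.GaloisRepresentations
open Literature.NumberTheory.GaloisRepresentations.DiscreteGaloisModule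

namespace DVRSetting

variable {p : ℕ} [Fact p.Prime] {K : Type} [Field K] [NumberField K]
  {R : Type} [CommRing R] [IsDomain R] [IsDiscreteValuationRing R] [Algebra ℤ_[p] R]
  {N : ℕ → Type} [∀ k, AddCommGroup (N k)] [∀ k, TopologicalSpace (N k)]
  [∀ k, DiscreteTopology (N k)] [∀ k, Module R (N k)]
  {Rk : ℕ → Type} [∀ k, CommRing (Rk k)] [∀ k, IsLocalRing (Rk k)] [∀ k, TopologicalSpace (Rk k)]
  [∀ k, DiscreteTopology (Rk k)] [∀ k, Algebra ℤ_[p] (Rk k)] [∀ k, Algebra R (Rk k)]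
  [∀ k, Module (Rk k) (N k)] [∀ k, IsScalarTower R (Rk k) (N k)]
  {Nbar : Type} [AddCommGroup Nbar] [TopologicalSpace Nbar] [DiscreteTopology Nbar]
  [∀ k, Module (Rk k) Nbar]
  {Nq : ℕ → Finset (HeightOneSpectrum (𝓞 K)) → Type} [∀ k n, AddCommGroup (Nq k n)]
  [∀ k n, TopologicalSpace (Nq k n)] [∀ k n, DiscreteTopology (Nq k n)]
  [∀ k n, Module (Rk k) (Nq k n)] [∀ k n, Module R (Nq k n)]
  [∀ k n, IsScalarTower R (Rk k) (Nq k n)]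

/-! ## §1 The modified structure `F(n)` propagates to `F♯(n)` along the marked-level bijection -/

/-- **`F(n)` on `T^{(k)}` propagates, along the marked-level presentation `proj : T^{(k)} → T/π^jT` (`host j ≤ k`,
`n ∈ 𝓝^{(k)}`), to `F♯(n)` on `T/π^jT`**: at the primes of `n` the transverse condition of `T^{(k)}` maps ONTO the
transverse condition of `T/π^jT` (both read «the cocycle dies on `Γ_L`», `Γ_L` acting trivially at `n ∈ 𝓝^{(k)}`;
`comap_cohomologyMap_transverseCondition_eq` + bijectivity of `H¹(K_λ, proj)` when `j = e_k`), elsewhere it is the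
definition of the refined condition (`refinedCond_apply_eq_map`).
[cite: Howard2004HeegnerKolyvagin, Def. 1.1.3, Def. 1.2.2, Lemma 1.5.1 and §1.6 (arXiv:1202.6340 p. 5 L93–99, p. 6 L101–125, p. 9 L127–133, p. 11 L33–38)] -/
theorem propagateStructure_atLevel_cond_eq_refinedTriple_atLevel (S : DVRSetting p K R N Rk Nbar Nq)
    (hy : S.SatisfiesH) {j k : ℕ} (hj : j = S.e k) (n : Finset (HeightOneSpectrum (𝓞 K)))
    (hn : ↑n ⊆ S.levelPrimes k) :
    ((S.piRefinementDatum hy).isQuotientBy_levelRep (S.host_le_of_eq_e hy hj)).propagateStructure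
        ((S.t k).atLevel S.jbar n).cond =
      ((S.refinedTriple hy j).atLevel S.jbar n).cond := by
  have hhost := S.host_le_of_eq_e hy hj
  have hq := (S.piRefinementDatum hy).isQuotientBy_levelRep hhost
  funext v
  rw [IsQuotientBy.propagateStructure_apply]
  rcases v with w | q
  · rw [SelmerTriple.atLevel_cond_inl, SelmerTriple.atLevel_cond_inl, refinedTriple_cond,
      S.refinedCond_apply_eq_map hy hhost]
  · by_cases hqn : q ∈ n
    · rw [SelmerTriple.atLevel_cond_inr_of_mem _ _ hqn, SelmerTriple.atLevel_cond_inr_of_mem _ _ hqn]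
      -- the transverse condition maps onto the transverse condition
      have htriv : ∀ g ∈ transverseFixer p (residueChar q) S.jbar q,
          ∀ y : (S.piRefinementDatum hy).Level j,
            GaloisRep.toLocal q ((S.piRefinementDatum hy).levelRep j) g y = y := by
        intro g hg y
        obtain ⟨x, rfl⟩ := (S.piRefinementDatum hy).proj_surjective hhost y
        rw [show GaloisRep.toLocal q ((S.piRefinementDatum hy).levelRep j) g ((S.piRefinementDatum hy).proj hhost x) =
            (S.piRefinementDatum hy).proj hhost (GaloisRep.toLocal q (S.T.ρ k) g x) from
          (hq.equivariant _ x).symm,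
          S.htriv_of_subset_levelPrimes hy hn k le_rfl q hqn g hg x]
      have hcomap := comap_cohomologyMap_transverseCondition_eq (p := p) (S.T.ρ k)
        ((S.piRefinementDatum hy).levelRep j) (residueChar q) S.jbar q
        ((S.piRefinementDatum hy).proj hhost).toAddMonoidHom (S.proj_bijective_of_eq_e hy hj).1
        (fun g x ↦ hq.equivariant _ x) htriv
      have hsurj := (hq.bijective_localCohomologyMap_of_ker_eq_bot
        (LinearMap.ker_eq_bot.mpr (S.proj_bijective_of_eq_e hy hj).1) (Sum.inr q)).2
      rw [← hcomap]
      exact AddSubgroup.map_comap_eq_self_of_surjective hsurj _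
    · rw [SelmerTriple.atLevel_cond_inr_of_not_mem _ _ hqn, SelmerTriple.atLevel_cond_inr_of_not_mem _ _ hqn,
        refinedTriple_cond, S.refinedCond_apply_eq_map hy hhost]

/-! ## §2 Generic: a marked-level presentation with `ker = 0` identifies the `F(n)`-Selmer groups -/

section Marked

variable {N' : ℕ → Type} [∀ k, AddCommGroup (N' k)] [∀ k, TopologicalSpace (N' k)]
  [∀ k, DiscreteTopology (N' k)] [∀ k, Module R (N' k)]
  {Rk' : ℕ → Type} [∀ k, CommRing (Rk' k)] [∀ k, IsLocalRing (Rk' k)] [∀ k, TopologicalSpace (Rk' k)]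
  [∀ k, DiscreteTopology (Rk' k)] [∀ k, Algebra ℤ_[p] (Rk' k)] [∀ k, Algebra R (Rk' k)]
  [∀ k, Module (Rk' k) (N' k)] [∀ k, IsScalarTower R (Rk' k) (N' k)]
  {Nbar' : Type} [AddCommGroup Nbar'] [TopologicalSpace Nbar'] [DiscreteTopology Nbar']
  [∀ k, Module (Rk' k) Nbar']
  {Nq' : ℕ → Finset (HeightOneSpectrum (𝓞 K)) → Type} [∀ k n, AddCommGroup (Nq' k n)]
  [∀ k n, TopologicalSpace (Nq' k n)] [∀ k n, DiscreteTopology (Nq' k n)]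
  [∀ k n, Module (Rk' k) (Nq' k n)] [∀ k n, Module R (Nq' k n)]
  [∀ k n, IsScalarTower R (Rk' k) (Nq' k n)]

/-- **A presentation `ι : T^{(k)} → T'^{(k')}` with `ker ι = 0` carrying `F(n)` to `F'(n)` is an `R`-equivariant additive
bijection `H¹_{F(n)}(K, T^{(k)}) ≃ H¹_{F'(n)}(K, T'^{(k')})`** (`H¹(K, ι)` bijective: `bijective_cohomologyMap_of_ker_eq_bot`;
Selmer onto Selmer: `cohomologyMap_mem_selmerGroup_propagateStructure_iff`; scalars: `cohomologyMap_scalarMapH1`).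
[cite: Howard2004HeegnerKolyvagin, Def. 1.1.3 and Lemma 1.3.3 (arXiv:1202.6340 p. 5 L93–99, p. 7 L152–160)] -/
theorem exists_selmerGroup_addEquiv_of_isQuotientBy (S : DVRSetting p K R N Rk Nbar Nq)
    (S' : DVRSetting p K R N' Rk' Nbar' Nq') (hy : S.SatisfiesH) (k k' : ℕ) {I : Ideal R}
    {ι : N k →ₗ[R] N' k'} (hιq : IsQuotientBy (S.T.ρ k) I (S'.T.ρ k') ι) (hιker : LinearMap.ker ι = ⊥)
    (n : Finset (HeightOneSpectrum (𝓞 K)))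
    (hF : hιq.propagateStructure ((S.t k).atLevel S.jbar n).cond = ((S'.t k').atLevel S'.jbar n).cond) :
    ∃ Φ : ↥(((S.t k).atLevel S.jbar n).cond).selmerGroup ≃+ ↥(((S'.t k').atLevel S'.jbar n).cond).selmerGroup,
      ∀ (r : R) (y : galoisCohomology (S.T.ρ k) 1) (hy₁ : y ∈ (((S.t k).atLevel S.jbar n).cond).selmerGroup),
        (Φ ⟨galoisCohomology.scalarMapH1 (S.T.ρ k) (S.T.hlin k) r y,
            S.scalarMapH1_mem_selmerGroup_atLevel hy k n r hy₁⟩).1 =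
          galoisCohomology.scalarMapH1 (S'.T.ρ k') (S'.T.hlin k') r (Φ ⟨y, hy₁⟩).1 := by
  have hmem : ∀ x : galoisCohomology (S.T.ρ k) 1,
      hιq.cohomologyMap 1 x ∈ (((S'.t k').atLevel S'.jbar n).cond).selmerGroup ↔
        x ∈ (((S.t k).atLevel S.jbar n).cond).selmerGroup := by
    intro x
    rw [← hF]
    exact hιq.cohomologyMap_mem_selmerGroup_propagateStructure_iff hιker ((S.t k).atLevel S.jbar n).cond x
  have hinj : Function.Injective (hιq.cohomologyMap 1) := (hιq.bijective_cohomologyMap_of_ker_eq_bot hιker).1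
  let φ : ↥(((S.t k).atLevel S.jbar n).cond).selmerGroup →+ ↥(((S'.t k').atLevel S'.jbar n).cond).selmerGroup :=
    AddMonoidHom.mk' (fun x ↦ ⟨hιq.cohomologyMap 1 x.1, (hmem x.1).2 x.2⟩)
      (fun x y ↦ Subtype.ext (map_add (hιq.cohomologyMap 1) x.1 y.1))
  have hφ : ∀ x, (φ x).1 = hιq.cohomologyMap 1 x.1 := fun _ ↦ rfl
  have hφinj : Function.Injective φ := fun x y hxy ↦
    Subtype.ext (hinj ((hφ x).symm.trans ((congrArg Subtype.val hxy).trans (hφ y))))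
  have hφsurj : Function.Surjective φ := by
    intro c
    have hc : c.1 ∈ (hιq.propagateStructure ((S.t k).atLevel S.jbar n).cond).selmerGroup := by
      rw [hF]; exact c.2
    obtain ⟨x, hx, hxc⟩ := hιq.exists_mem_selmerGroup_cohomologyMap_eq hιker ((S.t k).atLevel S.jbar n).cond hc
    exact ⟨⟨x, hx⟩, Subtype.ext ((hφ _).trans hxc)⟩
  refine ⟨AddEquiv.ofBijective φ ⟨hφinj, hφsurj⟩, fun r y hy₁ ↦ ?_⟩
  have e1 : (AddEquiv.ofBijective φ ⟨hφinj, hφsurj⟩ ⟨galoisCohomology.scalarMapH1 (S.T.ρ k) (S.T.hlin k) r y,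
        S.scalarMapH1_mem_selmerGroup_atLevel hy k n r hy₁⟩).1 =
      hιq.cohomologyMap 1 (galoisCohomology.scalarMapH1 (S.T.ρ k) (S.T.hlin k) r y) :=
    hφ ⟨galoisCohomology.scalarMapH1 (S.T.ρ k) (S.T.hlin k) r y, S.scalarMapH1_mem_selmerGroup_atLevel hy k n r hy₁⟩
  have e2 : hιq.cohomologyMap 1 (galoisCohomology.scalarMapH1 (S.T.ρ k) (S.T.hlin k) r y) =
      galoisCohomology.scalarMapH1 (S'.T.ρ k') (S'.T.hlin k') r (hιq.cohomologyMap 1 y) :=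
    cohomologyMap_scalarMapH1 (S.T.hlin k) (S'.T.hlin k') ι hιq.equivariant r y
  have e3 : (AddEquiv.ofBijective φ ⟨hφinj, hφsurj⟩ ⟨y, hy₁⟩).1 = hιq.cohomologyMap 1 y := hφ ⟨y, hy₁⟩
  exact e1.trans (e2.trans (congrArg (galoisCohomology.scalarMapH1 (S'.T.ρ k') (S'.T.hlin k') r) e3.symm))

/-- **`HasLevelDecompositionsAt` DESCENDS along marked levels.** Let `S`, `S'` be `DVRSetting`s over the same `R` with
H.0–H.5, and for every level `k` of `S` a marked level `σ k` of `S'` with the same exponent (`e'_{σ k} = e_k`), a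
presentation `ι_k : T^{(k)} → T'^{(σ k)}` with `ker ι_k = 0` carrying `F(n)` to `F'(n)` and `𝓝^{(k)} ⊆ 𝓝'^{(σ k)}` (for
`n ∈ 𝓝^{(k)}`).  Then Thm. 1.4.2-as-applied for `S'` gives it for `S` (transport the decomposition along §2's bijection and
fix the exponent of the free part by `e'_{σ k} = e_k`).
[cite: Howard2004HeegnerKolyvagin, Thm. 1.4.2, Lemma 1.3.3 and §1.6 (arXiv:1202.6340 p0008 L100–105, p. 7 L152–160, p. 11 L33–44)] -/
theorem hasLevelDecompositionsAt_of_marked (S : DVRSetting p K R N Rk Nbar Nq) (S' : DVRSetting p K R N' Rk' Nbar' Nq')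
    (hy : S.SatisfiesH) (hy' : S'.SatisfiesH) (σ : ℕ → ℕ) (hσ : ∀ k, S'.e (σ k) = S.e k) (I : ℕ → Ideal R)
    (ι : ∀ k, N k →ₗ[R] N' (σ k)) (hιq : ∀ k, IsQuotientBy (S.T.ρ k) (I k) (S'.T.ρ (σ k)) (ι k))
    (hιker : ∀ k, LinearMap.ker (ι k) = ⊥)
    (hF : ∀ (k : ℕ) (n : Finset (HeightOneSpectrum (𝓞 K))), ↑n ⊆ S.levelPrimes k →
      (hιq k).propagateStructure ((S.t k).atLevel S.jbar n).cond = ((S'.t (σ k)).atLevel S'.jbar n).cond)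
    (hprimes : ∀ (k : ℕ) (n : Finset (HeightOneSpectrum (𝓞 K))), ↑n ⊆ S.levelPrimes k → ↑n ⊆ S'.levelPrimes (σ k))
    (h : S'.HasLevelDecompositionsAt hy') : S.HasLevelDecompositionsAt hy := by
  intro k n hn
  obtain ⟨Φ, hΦ⟩ := S.exists_selmerGroup_addEquiv_of_isQuotientBy S' hy k (σ k) (hιq k) (hιker k) n (hF k n hn)
  obtain ⟨ε, hε, M, _, _, _, θ', hθ'⟩ := h (σ k) n (hprimes k n hn)
  have he : IsLocalRing.maximalIdeal R ^ S'.e (σ k) = IsLocalRing.maximalIdeal R ^ S.e k := by rw [hσ k]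
  let ψ : ((Fin ε → R ⧸ IsLocalRing.maximalIdeal R ^ S'.e (σ k)) × (M × M)) ≃ₗ[R]
      ((Fin ε → R ⧸ IsLocalRing.maximalIdeal R ^ S.e k) × (M × M)) :=
    LinearEquiv.prodCongr (LinearEquiv.piCongrRight fun _ ↦ Submodule.quotEquivOfEq _ _ he) (LinearEquiv.refl R _)
  refine ⟨ε, hε, M, inferInstance, inferInstance, inferInstance, (Φ.trans θ').trans ψ.toAddEquiv, fun r y hy₁ ↦ ?_⟩
  -- `R`-equivariance (term-mode `congrArg`s: keyed rewriting would unfold the cohomology maps)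
  have h1 : Φ ⟨galoisCohomology.scalarMapH1 (S.T.ρ k) (S.T.hlin k) r y, S.scalarMapH1_mem_selmerGroup_atLevel hy k n r hy₁⟩ =
      ⟨galoisCohomology.scalarMapH1 (S'.T.ρ (σ k)) (S'.T.hlin (σ k)) r (Φ ⟨y, hy₁⟩).1,
        S'.scalarMapH1_mem_selmerGroup_atLevel hy' (σ k) n r (Φ ⟨y, hy₁⟩).2⟩ :=
    Subtype.ext (hΦ r y hy₁)
  have h3 := hθ' r (Φ ⟨y, hy₁⟩).1 (Φ ⟨y, hy₁⟩).2
  show ψ (θ' (Φ ⟨galoisCohomology.scalarMapH1 (S.T.ρ k) (S.T.hlin k) r y,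
      S.scalarMapH1_mem_selmerGroup_atLevel hy k n r hy₁⟩)) = r • ψ (θ' (Φ ⟨y, hy₁⟩))
  calc ψ (θ' (Φ ⟨galoisCohomology.scalarMapH1 (S.T.ρ k) (S.T.hlin k) r y,
          S.scalarMapH1_mem_selmerGroup_atLevel hy k n r hy₁⟩))
        = ψ (θ' ⟨galoisCohomology.scalarMapH1 (S'.T.ρ (σ k)) (S'.T.hlin (σ k)) r (Φ ⟨y, hy₁⟩).1,
            S'.scalarMapH1_mem_selmerGroup_atLevel hy' (σ k) n r (Φ ⟨y, hy₁⟩).2⟩) := congrArg (fun z ↦ ψ (θ' z)) h1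
    _ = ψ (r • θ' ⟨(Φ ⟨y, hy₁⟩).1, (Φ ⟨y, hy₁⟩).2⟩) := congrArg ψ h3
    _ = r • ψ (θ' ⟨(Φ ⟨y, hy₁⟩).1, (Φ ⟨y, hy₁⟩).2⟩) := map_smul ψ r _

end Marked

/-! ## §3 The instantiation at the `π`-adic refinement: `HasLevelDecompositionsAt` descends along `S.refine` -/

/-- `n ∈ 𝓝^{(k)}` for `S` gives `n ∈ 𝓝♯^{(i)}` for the refined setting at the marked index `i + 1 = e_k` (same `𝓛`, and
`𝓛_{e_k}(T) ⊆ 𝓛_{e_k}` of the refined tower, `kolyvaginPrimes_subset_refinedTower`).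
[cite: Howard2004HeegnerKolyvagin, §1.6 (arXiv:1202.6340 p. 11 L33–38)] -/
theorem subset_levelPrimes_refine (S : DVRSetting p K R N Rk Nbar Nq) (hy : S.SatisfiesH)
    (pins : ∀ v : HeightOneSpectrum (𝓞 K), TamePin v) {k i : ℕ} (hi : i + 1 = S.e k)
    {n : Finset (HeightOneSpectrum (𝓞 K))} (hn : ↑n ⊆ S.levelPrimes k) :
    letI : ∀ i, TopologicalSpace (S.QuotRing (i + 1)) := fun i => S.refineInstTop i
    haveI : ∀ i, DiscreteTopology (S.QuotRing (i + 1)) := fun i => S.refineInst_discrete i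
    haveI : ∀ i, IsLocalRing (S.QuotRing (i + 1)) := fun i => S.refineInst_isLocalRing hy i
    letI : ∀ i, Module (S.QuotRing (i + 1)) Nbar := fun i => S.residualModule hy i
    ↑n ⊆ (S.refine hy pins).levelPrimes i := by
  letI : ∀ i, TopologicalSpace (S.QuotRing (i + 1)) := fun i => S.refineInstTop i
  haveI : ∀ i, DiscreteTopology (S.QuotRing (i + 1)) := fun i => S.refineInst_discrete i
  haveI : ∀ i, IsLocalRing (S.QuotRing (i + 1)) := fun i => S.refineInst_isLocalRing hy i
  letI : ∀ i, Module (S.QuotRing (i + 1)) Nbar := fun i => S.residualModule hy i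
  have hLP : (S.refine hy pins).levelPrimes i =
      {v | v ∈ S.L ∧ v ∈ (S.refinedTower hy).kolyvaginPrimes p (i + 1)} := rfl
  rw [hLP]
  intro v hv
  have hv2 : v ∈ S.T.kolyvaginPrimes p (i + 1) := by rw [hi]; exact (hn hv).2
  exact ⟨(hn hv).1, S.kolyvaginPrimes_subset_refinedTower hy (i + 1) hv2⟩

/-- **Thm. 1.4.2-as-applied DESCENDS along the `π`-adic refinement.** If the refined (full) setting `S.refine hy pins`
(levels `T/π^{i+1}T`, `e♯ i = i + 1`) has `HasLevelDecompositionsAt`, so does `S` — `hasLevelDecompositionsAt_of_marked` at the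
marked levels `σ k = e_k - 1` with the bijections `proj : T^{(k)} → T/π^{e_k}T` of R1 §5 (`proj_bijective_of_eq_e`,
`isQuotientBy_levelRep`), the structures by §1 and the prime sets by `subset_levelPrimes_refine`.  Hence (§4) the leaf
C45.1′ follows from `HasLevelDecompositionsAt` on FULL settings alone.
[cite: Howard2004HeegnerKolyvagin, §1.6 with Rem. 1.3.1 and Thm. 1.4.2 (arXiv:1202.6340 p. 11 L33–44, p. 7 L125–127)] -/
theorem hasLevelDecompositionsAt_of_refine (S : DVRSetting p K R N Rk Nbar Nq) (hy : S.SatisfiesH)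
    (pins : ∀ v : HeightOneSpectrum (𝓞 K), TamePin v)
    (h : letI : ∀ i, TopologicalSpace (S.QuotRing (i + 1)) := fun i => S.refineInstTop i
      haveI : ∀ i, DiscreteTopology (S.QuotRing (i + 1)) := fun i => S.refineInst_discrete i
      haveI : ∀ i, IsLocalRing (S.QuotRing (i + 1)) := fun i => S.refineInst_isLocalRing hy i
      letI : ∀ i, Module (S.QuotRing (i + 1)) Nbar := fun i => S.residualModule hy i
      (S.refine hy pins).HasLevelDecompositionsAt (S.refine_satisfiesH hy pins)) :
    S.HasLevelDecompositionsAt hy := by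
  letI : ∀ i, TopologicalSpace (S.QuotRing (i + 1)) := fun i => S.refineInstTop i
  haveI : ∀ i, DiscreteTopology (S.QuotRing (i + 1)) := fun i => S.refineInst_discrete i
  haveI : ∀ i, IsLocalRing (S.QuotRing (i + 1)) := fun i => S.refineInst_isLocalRing hy i
  letI : ∀ i, Module (S.QuotRing (i + 1)) Nbar := fun i => S.residualModule hy i
  have heσ : ∀ k, S.e k - 1 + 1 = S.e k := fun k ↦ Nat.sub_add_cancel (S.one_le_e hy k)
  exact S.hasLevelDecompositionsAt_of_marked (S.refine hy pins) hy (S.refine_satisfiesH hy pins) (fun k ↦ S.e k - 1) heσ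
    (fun k ↦ Ideal.span {(S.piRefinementDatum hy).π ^ (S.e k - 1 + 1)})
    (fun k ↦ (S.piRefinementDatum hy).proj (S.host_le_of_eq_e hy (heσ k)))
    (fun k ↦ (S.piRefinementDatum hy).isQuotientBy_levelRep (S.host_le_of_eq_e hy (heσ k)))
    (fun k ↦ LinearMap.ker_eq_bot.mpr (S.proj_bijective_of_eq_e hy (heσ k)).1)
    (fun k n hn ↦ S.propagateStructure_atLevel_cond_eq_refinedTriple_atLevel hy (heσ k) n hn)
    (fun k n hn ↦ S.subset_levelPrimes_refine hy pins (heσ k) hn) h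

end DVRSetting

/-! ## §4 The leaf C45.1′ from FULL settings alone -/

/-- **THE FLACH LEAF FROM FULL TOWERS.** If every FULL `DVRSetting` (`e_i = i + 1`: Howard's own tower `T^{(k)} = T/𝔪^kT`)
with H.0–H.5 has `HasLevelDecompositionsAt` (Thm. 1.4.2 for every `(T^{(k)}, 𝓕(n))`, `n ∈ 𝓝^{(k)}`), then the typed print leaf
`prop141_casselsTate_skewPairing_atLevel` holds (for EVERY setting): refine an arbitrary setting (`S.refine hy pins`,
`nonempty_tamePin`), read the decomposition there, descend (`hasLevelDecompositionsAt_of_refine`), and conclude by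
`prop141_casselsTate_skewPairing_atLevel_of_forall_hasLevelDecompositionsAt`.  So a kernel proof of Thm. 1.4.2 on full towers —
where `T/𝔪^sT` and `T*[𝔪^t] ≅ Tw(T/𝔪^tT)` are tower LEVELS — closes the leaf BY NAME.
[cite: Howard2004HeegnerKolyvagin, Prop. 1.4.1, Thm. 1.4.2 and §1.6 with Rem. 1.3.1 (arXiv:1202.6340 p0008 L83–L142, p0011 L33–44, p0007 L125–127)] -/
theorem prop141_casselsTate_skewPairing_atLevel_of_forall_full_hasLevelDecompositionsAt
    (h : ∀ (p : ℕ) [Fact p.Prime] (K : Type) [Field K] [NumberField K]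
      (R : Type) [CommRing R] [IsDomain R] [IsDiscreteValuationRing R] [Algebra ℤ_[p] R]
      (N : ℕ → Type) [∀ k, AddCommGroup (N k)] [∀ k, TopologicalSpace (N k)]
      [∀ k, DiscreteTopology (N k)] [∀ k, Module R (N k)]
      (Rk : ℕ → Type) [∀ k, CommRing (Rk k)] [∀ k, IsLocalRing (Rk k)] [∀ k, TopologicalSpace (Rk k)]
      [∀ k, DiscreteTopology (Rk k)] [∀ k, Algebra ℤ_[p] (Rk k)] [∀ k, Algebra R (Rk k)]
      [∀ k, Module (Rk k) (N k)] [∀ k, IsScalarTower R (Rk k) (N k)]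
      (Nbar : Type) [AddCommGroup Nbar] [TopologicalSpace Nbar] [DiscreteTopology Nbar]
      [∀ k, Module (Rk k) Nbar]
      (Nq : ℕ → Finset (HeightOneSpectrum (𝓞 K)) → Type) [∀ k n, AddCommGroup (Nq k n)]
      [∀ k n, TopologicalSpace (Nq k n)] [∀ k n, DiscreteTopology (Nq k n)]
      [∀ k n, Module (Rk k) (Nq k n)] [∀ k n, Module R (Nq k n)]
      [∀ k n, IsScalarTower R (Rk k) (Nq k n)]
      (S : DVRSetting p K R N Rk Nbar Nq) (hy : S.SatisfiesH), (∀ i, S.e i = i + 1) → S.HasLevelDecompositionsAt hy) :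
    prop141_casselsTate_skewPairing_atLevel := by
  refine prop141_casselsTate_skewPairing_atLevel_of_forall_hasLevelDecompositionsAt ?_
  intro p _ K _ _ R _ _ _ _ N _ _ _ _ Rk _ _ _ _ _ _ _ _ Nbar _ _ _ _ Nq _ _ _ _ _ _ S hy
  let pins : ∀ v : HeightOneSpectrum (𝓞 K), TamePin v := fun v ↦ (nonempty_tamePin v).some
  letI : ∀ i, TopologicalSpace (S.QuotRing (i + 1)) := fun i ↦ S.refineInstTop i
  haveI : ∀ i, DiscreteTopology (S.QuotRing (i + 1)) := fun i ↦ S.refineInst_discrete i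
  haveI : ∀ i, IsLocalRing (S.QuotRing (i + 1)) := fun i ↦ S.refineInst_isLocalRing hy i
  letI : ∀ i, Module (S.QuotRing (i + 1)) Nbar := fun i ↦ S.residualModule hy i
  exact S.hasLevelDecompositionsAt_of_refine hy pins
    (h p K R _ _ Nbar _ (S.refine hy pins) (S.refine_satisfiesH hy pins) (fun _ ↦ rfl))

/-- **C45.1′ ⟺ Thm. 1.4.2-as-applied on FULL settings** (`e_i = i + 1`).
[cite: Howard2004HeegnerKolyvagin, Prop. 1.4.1, Thm. 1.4.2 and §1.6 with Rem. 1.3.1 (arXiv:1202.6340 p0008 L83–L142, p0011 L33–44, p0007 L125–127)] -/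
theorem prop141_casselsTate_skewPairing_atLevel_iff_forall_full_hasLevelDecompositionsAt :
    prop141_casselsTate_skewPairing_atLevel ↔
    ∀ (p : ℕ) [Fact p.Prime] (K : Type) [Field K] [NumberField K]
      (R : Type) [CommRing R] [IsDomain R] [IsDiscreteValuationRing R] [Algebra ℤ_[p] R]
      (N : ℕ → Type) [∀ k, AddCommGroup (N k)] [∀ k, TopologicalSpace (N k)]
      [∀ k, DiscreteTopology (N k)] [∀ k, Module R (N k)]
      (Rk : ℕ → Type) [∀ k, CommRing (Rk k)] [∀ k, IsLocalRing (Rk k)] [∀ k, TopologicalSpace (Rk k)]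
      [∀ k, DiscreteTopology (Rk k)] [∀ k, Algebra ℤ_[p] (Rk k)] [∀ k, Algebra R (Rk k)]
      [∀ k, Module (Rk k) (N k)] [∀ k, IsScalarTower R (Rk k) (N k)]
      (Nbar : Type) [AddCommGroup Nbar] [TopologicalSpace Nbar] [DiscreteTopology Nbar]
      [∀ k, Module (Rk k) Nbar]
      (Nq : ℕ → Finset (HeightOneSpectrum (𝓞 K)) → Type) [∀ k n, AddCommGroup (Nq k n)]
      [∀ k n, TopologicalSpace (Nq k n)] [∀ k n, DiscreteTopology (Nq k n)]
      [∀ k n, Module (Rk k) (Nq k n)] [∀ k n, Module R (Nq k n)]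
      [∀ k n, IsScalarTower R (Rk k) (Nq k n)]
      (S : DVRSetting p K R N Rk Nbar Nq) (hy : S.SatisfiesH), (∀ i, S.e i = i + 1) → S.HasLevelDecompositionsAt hy :=
  ⟨fun h141 _ _ _ _ _ _ _ _ _ _ _ _ _ _ _ _ _ _ _ _ _ _ _ _ _ _ _ _ _ _ _ _ _ _ _ _ S hy _ ↦
      S.hasLevelDecompositionsAt_of_prop141 h141 hy,
    prop141_casselsTate_skewPairing_atLevel_of_forall_full_hasLevelDecompositionsAt⟩

/-- **C45.1′ ⟺ EVEN LAYERS ON FULL TOWERS**: the typed Flach leaf holds iff for every FULL `DVRSetting` with H.0–H.5, every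
level `k`, every `n ∈ 𝓝^{(k)}` and every `t + 1 < e_k = k + 1`, Howard's layer `𝓗(n)[π^{t+1}]/(𝓗(n)[π^t] + π·𝓗(n)[π^{t+2}])` of
`𝓗(n) = H¹_{𝓕(n)}(K, T/𝔪^{k+1}T)` has even length («`V_s/V_{s-1}` is even dimensional») — the cheapest data-free target for a
kernel proof of the leaf. [cite: Howard2004HeegnerKolyvagin, Thm. 1.4.2 (proof) and §1.6 ¶1 (arXiv:1202.6340 p0008 L104–L139, p0011 L33–44)] -/
theorem prop141_casselsTate_skewPairing_atLevel_iff_forall_full_even_length_torsionLayer :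
    prop141_casselsTate_skewPairing_atLevel ↔
    ∀ (p : ℕ) [Fact p.Prime] (K : Type) [Field K] [NumberField K]
      (R : Type) [CommRing R] [IsDomain R] [IsDiscreteValuationRing R] [Algebra ℤ_[p] R]
      (N : ℕ → Type) [∀ k, AddCommGroup (N k)] [∀ k, TopologicalSpace (N k)]
      [∀ k, DiscreteTopology (N k)] [∀ k, Module R (N k)]
      (Rk : ℕ → Type) [∀ k, CommRing (Rk k)] [∀ k, IsLocalRing (Rk k)] [∀ k, TopologicalSpace (Rk k)]
      [∀ k, DiscreteTopology (Rk k)] [∀ k, Algebra ℤ_[p] (Rk k)] [∀ k, Algebra R (Rk k)]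
      [∀ k, Module (Rk k) (N k)] [∀ k, IsScalarTower R (Rk k) (N k)]
      (Nbar : Type) [AddCommGroup Nbar] [TopologicalSpace Nbar] [DiscreteTopology Nbar]
      [∀ k, Module (Rk k) Nbar]
      (Nq : ℕ → Finset (HeightOneSpectrum (𝓞 K)) → Type) [∀ k n, AddCommGroup (Nq k n)]
      [∀ k n, TopologicalSpace (Nq k n)] [∀ k n, DiscreteTopology (Nq k n)]
      [∀ k n, Module (Rk k) (Nq k n)] [∀ k n, Module R (Nq k n)]
      [∀ k n, IsScalarTower R (Rk k) (Nq k n)]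
      (S : DVRSetting p K R N Rk Nbar Nq) (hy : S.SatisfiesH), (∀ i, S.e i = i + 1) →
      ∀ (k : ℕ) (n : Finset (HeightOneSpectrum (𝓞 K))), ↑n ⊆ S.levelPrimes k → ∀ t : ℕ, t + 1 < S.e k →
        letI := galoisCohomology.moduleH1 (S.T.ρ k) (S.T.hlin k)
        Even (Module.length R ((↥(Submodule.torsionBy R ↥(S.selmerModuleAt hy k n) (S.π ^ (t + 1)))) ⧸
          Submodule.comap (Submodule.torsionBy R ↥(S.selmerModuleAt hy k n) (S.π ^ (t + 1))).subtype
            (Submodule.torsionBy R ↥(S.selmerModuleAt hy k n) (S.π ^ t) ⊔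
              S.π • Submodule.torsionBy R ↥(S.selmerModuleAt hy k n) (S.π ^ (t + 2))))) := by
  rw [prop141_casselsTate_skewPairing_atLevel_iff_forall_full_hasLevelDecompositionsAt]
  refine ⟨fun h _ _ _ _ _ _ _ _ _ _ _ _ _ _ _ _ _ _ _ _ _ _ _ _ _ _ _ _ _ _ _ _ _ _ _ _ S hy hfull ↦
      (S.hasLevelDecompositionsAt_iff_forall_even_length_torsionLayer hy).1 (h _ _ _ _ _ _ _ S hy hfull),
    fun h _ _ _ _ _ _ _ _ _ _ _ _ _ _ _ _ _ _ _ _ _ _ _ _ _ _ _ _ _ _ _ _ _ _ _ _ S hy hfull ↦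
      (S.hasLevelDecompositionsAt_iff_forall_even_length_torsionLayer hy).2 (h _ _ _ _ _ _ _ S hy hfull)⟩

end Literature.NumberTheory.GaloisCohomology.Howard2004

end
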